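import Mathlib
import Literature.NumberTheory.DiophantineGeometry.BombieriPila
import HarnessLib

/-!
# The superelliptic curves `Y^a = f(X)`: absolute irreducibility and degree

Helper file for item stmt-Parity-0874 (`LambdaToCount`, routes PolynomialMobius / IsogenyRedei /
…): for an irreducible `f ∈ ℤ[X]` of positive degree and `a ≥ 1`, the plane curve
`X₁^a − f(X₀) ∈ ℤ[X₀, X₁]` is absolutely irreducible (Eisenstein at a simple complex root of
`f`) and has total degree `≥ max a (deg f)`; its integral points `(n, p)` are exactly the
solutions of `f(n) = p^a`. These are the inputs Bombieri–Pila's theorem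
(`Literature.NumberTheory.DiophantineGeometry.Dioph.bombieriPila_card_integralPointsInBox_le`)
needs to bound the number of proper prime-power values of `f`.
-/

open Polynomial Bivariate

namespace Summit.Parity.BatemanHorn.LambdaToCount

/-- Eisenstein at a simple root: if `g ∈ K[X]` (`K` a field) is squarefree and has a root `α`,
then `Y^a − g(X) ∈ K[X][Y]` is irreducible for every `a ≥ 1` (Eisenstein's criterion at the
prime `X − α` of `K[X]`). -/
theorem irreducible_Y_pow_sub_C {K : Type*} [Field K] {g : K[X]} (hg : Squarefree g) {α : K}
    (hα : g.IsRoot α) {a : ℕ} (ha : 0 < a) : Irreducible (Y ^ a - C g : K[X][Y]) := by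
  set P : Ideal K[X] := Ideal.span {X - C α}
  have hprime : Prime (X - C α : K[X]) := prime_X_sub_C α
  have hP : P.IsPrime := (Ideal.span_singleton_prime hprime.ne_zero).mpr hprime
  have hdeg : (Y ^ a - C g : K[X][Y]).degree = a := degree_X_pow_sub_C ha g
  have hlc : (Y ^ a - C g : K[X][Y]).leadingCoeff = 1 := leadingCoeff_X_pow_sub_C ha
  refine irreducible_of_eisenstein_criterion hP ?_ ?_ ?_ ?_ ?_
  · rw [hlc]
    exact fun h => hP.ne_top ((Ideal.eq_top_iff_one P).mpr h)
  · intro n hn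
    rw [hdeg] at hn
    have hn' : n < a := by exact_mod_cast hn
    rw [coeff_sub, coeff_X_pow, if_neg hn'.ne, zero_sub, coeff_C]
    split_ifs with h0
    · exact P.neg_mem (Ideal.mem_span_singleton.mpr (dvd_iff_isRoot.mpr hα))
    · rw [neg_zero]
      exact P.zero_mem
  · rw [hdeg]
    exact_mod_cast ha
  · rw [coeff_sub, coeff_X_pow, if_neg (Nat.pos_iff_ne_zero.mp ha).symm, zero_sub, coeff_C,
      if_pos rfl]
    unfold P
    rw [Ideal.span_singleton_pow, Ideal.mem_span_singleton, dvd_neg, sq]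
    intro hdvd
    exact hprime.not_unit (hg _ hdvd)
  · exact (monic_X_pow_sub_C g (Nat.pos_iff_ne_zero.mp ha)).isPrimitive

/-- The bivariate polynomial `Y^a − f(X)` corresponds, under Mathlib's equivalence
`R[X][Y] ≃ₐ[R] R[X₀, X₁]` (`X ↦ X₀`, `Y ↦ X₁`), to `X₁^a − f(X₀)`. -/
theorem equivMvPolynomial_Y_pow_sub_C {R : Type*} [CommRing R] (f : R[X]) (a : ℕ) :
    equivMvPolynomial R (Y ^ a - C f) = MvPolynomial.X 1 ^ a - f.toMvPolynomial 0 := by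
  rw [map_sub, map_pow, equivMvPolynomial_X]
  congr 1
  rw [show equivMvPolynomial R (C f) = aevalAeval (MvPolynomial.X 0) (MvPolynomial.X 1) (C f)
    from rfl, aevalAeval_C]
  rfl

/-- Base change of `X₁^a − f(X₀)` from `ℤ` to `ℂ`. -/
theorem map_X_pow_sub_toMvPolynomial (f : ℤ[X]) (a : ℕ) :
    MvPolynomial.map (algebraMap ℤ ℂ)
        (MvPolynomial.X 1 ^ a - f.toMvPolynomial 0 : MvPolynomial (Fin 2) ℤ) =
      MvPolynomial.X 1 ^ a - (f.map (algebraMap ℤ ℂ)).toMvPolynomial 0 := by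
  rw [map_sub, map_pow, MvPolynomial.map_X]
  congr 1
  have h : (algebraMap ℂ (MvPolynomial (Fin 2) ℂ)).comp (algebraMap ℤ ℂ) =
      (MvPolynomial.map (algebraMap ℤ ℂ)).comp (algebraMap ℤ (MvPolynomial (Fin 2) ℤ)) :=
    RingHom.ext_int _ _
  have := Polynomial.map_aeval_eq_aeval_map h f (MvPolynomial.X (0 : Fin 2))
  rw [MvPolynomial.map_X] at this
  exact this

/-- **Absolute irreducibility of `Y^a = f(X)`.** For `f ∈ ℤ[X]` irreducible of positive degree
and `a ≥ 1`, the polynomial `X₁^a − f(X₀) ∈ ℤ[X₀, X₁]` is absolutely irreducible (irreducible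
over `ℂ`): `f` is primitive, hence irreducible over `ℚ` (Gauss), hence separable, so it has a
simple complex root `α`, and `Y^a − f` is Eisenstein at `X − α`. -/
theorem isAbsolutelyIrreducible_X_pow_sub_toMvPolynomial {f : ℤ[X]} (hf : Irreducible f)
    (hd : 0 < f.natDegree) {a : ℕ} (ha : 0 < a) :
    Literature.NumberTheory.DiophantineGeometry.Dioph.IsAbsolutelyIrreducible
      (MvPolynomial.X 1 ^ a - f.toMvPolynomial 0) := by
  unfold Literature.NumberTheory.DiophantineGeometry.Dioph.IsAbsolutelyIrreducible
  rw [map_X_pow_sub_toMvPolynomial, ← equivMvPolynomial_Y_pow_sub_C,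
    MulEquiv.irreducible_iff (equivMvPolynomial ℂ)]
  have hprim : f.IsPrimitive := hf.isPrimitive hd.ne'
  have hirrQ : Irreducible (f.map (Int.castRingHom ℚ)) :=
    (IsPrimitive.Int.irreducible_iff_irreducible_map_cast hprim).mp hf
  have hsepQ : (f.map (Int.castRingHom ℚ)).Separable := hirrQ.separable
  have hg : f.map (algebraMap ℤ ℂ) = (f.map (Int.castRingHom ℚ)).map (algebraMap ℚ ℂ) := by
    rw [Polynomial.map_map]
    congr 1
  have hsq : Squarefree (f.map (algebraMap ℤ ℂ)) := by
    rw [hg]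
    exact hsepQ.map.squarefree
  have hdeg : 0 < (f.map (algebraMap ℤ ℂ)).degree := by
    rw [degree_map_eq_of_injective (RingHom.injective_int (algebraMap ℤ ℂ)),
      ← natDegree_pos_iff_degree_pos]
    exact hd
  obtain ⟨α, hα⟩ := Complex.exists_root hdeg
  exact irreducible_Y_pow_sub_C hsq hα ha

/-- `f(X₀) ∈ R[X₀, X₁]` written out in monomials. -/
theorem toMvPolynomial_eq_sum {R : Type*} [CommRing R] (f : R[X]) :
    (f.toMvPolynomial (0 : Fin 2) : MvPolynomial (Fin 2) R) =
      ∑ j ∈ Finset.range (f.natDegree + 1),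
        MvPolynomial.monomial (Finsupp.single 0 j) (f.coeff j) := by
  change Polynomial.aeval (MvPolynomial.X (0 : Fin 2)) f = _
  rw [Polynomial.aeval_eq_sum_range]
  refine Finset.sum_congr rfl fun j _ => ?_
  rw [MvPolynomial.smul_eq_C_mul, MvPolynomial.C_mul_X_pow_eq_monomial]

/-- The coefficient of `X₀^e₀ X₁^e₁`-type monomials in `f(X₀)`: only pure powers of `X₀` occur. -/
theorem coeff_toMvPolynomial {R : Type*} [CommRing R] (f : R[X]) (m : Fin 2 →₀ ℕ) :
    MvPolynomial.coeff m (f.toMvPolynomial (0 : Fin 2) : MvPolynomial (Fin 2) R) =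
      if m = Finsupp.single 0 (m 0) then f.coeff (m 0) else 0 := by
  rw [toMvPolynomial_eq_sum, MvPolynomial.coeff_sum]
  simp only [MvPolynomial.coeff_monomial]
  split_ifs with hm
  · rw [Finset.sum_eq_single (m 0)]
    · rw [if_pos hm.symm]
    · intro j _ hj
      rw [if_neg]
      intro h
      apply hj
      have := congrArg (fun g : Fin 2 →₀ ℕ => g 0) h
      simpa using this
    · intro hj
      rw [if_pos hm.symm]
      exact coeff_eq_zero_of_natDegree_lt (by simpa using hj)
  · refine Finset.sum_eq_zero fun j _ => ?_
    rw [if_neg]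
    intro h
    apply hm
    rw [← h]
    simp

/-- **Degree of `Y^a = f(X)`.** `max a (deg f) ≤ totalDegree (X₁^a − f(X₀))` for `a ≥ 1`
(the monomials `X₁^a` and `X₀^{deg f}` occur with coefficients `1` and `−lead(f) ≠ 0`). -/
theorem le_totalDegree_X_pow_sub_toMvPolynomial {f : ℤ[X]} (hd : 0 < f.natDegree) {a : ℕ}
    (ha : 0 < a) :
    max a f.natDegree ≤
      (MvPolynomial.X 1 ^ a - f.toMvPolynomial 0 : MvPolynomial (Fin 2) ℤ).totalDegree := by
  have hf0 : f.leadingCoeff ≠ 0 := by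
    rw [Ne, leadingCoeff_eq_zero]
    rintro rfl
    simp at hd
  refine max_le ?_ ?_
  · -- the monomial `X₁^a`
    have hmem : Finsupp.single (1 : Fin 2) a ∈
        (MvPolynomial.X 1 ^ a - f.toMvPolynomial 0 : MvPolynomial (Fin 2) ℤ).support := by
      rw [MvPolynomial.mem_support_iff, MvPolynomial.coeff_sub, MvPolynomial.coeff_X_pow,
        if_pos rfl, coeff_toMvPolynomial, if_neg]
      · norm_num
      · intro h
        have := congrArg (fun g : Fin 2 →₀ ℕ => g 1) h
        simp only [Finsupp.single_eq_same] at this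
        rw [Finsupp.single_apply, if_neg (by decide)] at this
        exact (Nat.pos_iff_ne_zero.mp ha) this
    have := MvPolynomial.le_totalDegree hmem
    simpa using this
  · -- the monomial `X₀^(deg f)`
    have hmem : Finsupp.single (0 : Fin 2) f.natDegree ∈
        (MvPolynomial.X 1 ^ a - f.toMvPolynomial 0 : MvPolynomial (Fin 2) ℤ).support := by
      rw [MvPolynomial.mem_support_iff, MvPolynomial.coeff_sub, MvPolynomial.coeff_X_pow,
        if_neg, coeff_toMvPolynomial, if_pos]
      · simpa using hf0
      · simp
      · intro h
        have := congrArg (fun g : Fin 2 →₀ ℕ => g 1) h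
        simp only [Finsupp.single_eq_same] at this
        rw [Finsupp.single_apply, if_neg (by decide)] at this
        exact (Nat.pos_iff_ne_zero.mp ha) this
    have := MvPolynomial.le_totalDegree hmem
    simpa using this

/-- Integral points of `X₁^a − f(X₀)`: `(n, p)` lies on the curve iff `p^a = f(n)`. -/
theorem eval_X_pow_sub_toMvPolynomial (f : ℤ[X]) (a : ℕ) (n p : ℤ) :
    MvPolynomial.eval ![n, p] (MvPolynomial.X 1 ^ a - f.toMvPolynomial 0 : MvPolynomial (Fin 2) ℤ) =
      p ^ a - f.eval n := by
  simp [MvPolynomial.eval_toMvPolynomial]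

/-! ### Exponent bookkeeping for the Bombieri–Pila box `[-N, N]²`, `N = A·x^⌈d/a⌉` -/

/-- The exponent bookkeeping: with `e = ⌈d/a⌉ = (d + a - 1)/a` and `m = max a d` one has
`4e ≤ 3m` (for `a ≥ 2`, `d ≥ 1`). -/
theorem four_mul_ceilDiv_le {a d : ℕ} (ha : 2 ≤ a) (hd : 1 ≤ d) :
    4 * ((d + a - 1) / a) ≤ 3 * max a d := by
  rcases le_or_gt a d with had | had
  · -- `a ≤ d`: `4(d+a-1) ≤ 3ad`
    rw [max_eq_right had]
    refine (Nat.mul_div_le_mul_div_assoc _ _ _).trans (Nat.div_le_of_le_mul ?_)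
    have h1 : 1 ≤ d + a := by omega
    have key : (3 * a - 4) * a ≤ (3 * a - 4) * d := Nat.mul_le_mul_left _ had
    zify [h1, (by omega : 4 ≤ 3 * a)] at key ⊢
    nlinarith
  · -- `d < a`: `e = 1`
    rw [max_eq_left had.le, Nat.div_eq_of_lt_le (k := 1) (by omega) (by omega)]
    omega

/-- `d ≤ e·a` for `e = ⌈d/a⌉ = (d + a - 1)/a`, `a ≥ 1`. -/
theorem le_ceilDiv_mul {a d : ℕ} (ha : 1 ≤ a) : d ≤ (d + a - 1) / a * a := by
  have := Nat.lt_div_mul_add (a := d + a - 1) (by omega : 0 < a)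
  omega

end Summit.Parity.BatemanHorn.LambdaToCount
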